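import Literature.AnabelianGeometry.AbsoluteAnabelian.AbsTopII.SemiEllipticTorsionFree
import Literature.AnabelianGeometry.AbsoluteAnabelian.AbsTopII.EllipticCuspidalizationComparisonPrimeProofs
import Literature.AnabelianGeometry.AbsoluteAnabelian.FreeProSigmaTorsionFree
import HarnessLib

/-!
# [AbsTopII] Cor 3.3 (ii): SEPARATION of the two renderings of "torsion-free" at the corollary's own
# statements — the unique-roots predecessors are FALSE at one non-`IsMulTorsionFree` double cover, the
# print-faithful clause HOLDS at free pro-`Σ` `Δ` (kernel proofs)

S. Mochizuki, *Topics in Absolute Anabelian Geometry II: Decomposition Groups and Endomorphisms*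
[AbsTopII] (bib `MochizukiAbsTopII2013`; kurims manuscript `paper:url-585b8d0ad0d9`, cell render
`HOME/lit/renders/AbsTopII-kurims-url-585b8d0ad0d9/p0068.txt` l.7–11), §3, Corollary 3.3 (ii) p. 68:
"… may be characterized 'group-theoretically' as the collection of open subgroups `J ⊆ Π_C` of index
`2` such that `J ∩ Δ_C` [where `Δ_C := Ker(Π_C ↠ G')`] is torsion-free [i.e., the covering determined
by `J` is a scheme — cf. [AbsTopI], Lemma 4.1, (iv)]."

PROOF-ONLY file (cell abc-iut, row «TORSIONFREE-SUCCESSOR», abc-iut-L4-lead m151 (6); seat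
abc-iut-L4-t4 gen 12; file 4 of the row).  Finding T1g11-F1 (abc-iut-L5-t1) at the level of the
Cor 3.3 (ii) NAMED FACTS themselves:
* NEGATIVE — `cor_3_3_ii_false_of` (abc-iut-L4-t6's `Cor_3_3_ii`, F-0234),
  `EllipticModel.cor_3_3_ii_false_of` (F-0290), `EllipticDatumModel.cor_3_3_ii'_false_of`
  (abc-iut-L4-t4's datum retype): ONE double covering on the scheme side whose `Π_D ∩ Δ_C` is not
  `IsMulTorsionFree` makes the predecessor FALSE (not merely vacuous).  The genuine instance of the
  hypothesis — `Π_D ∩ Δ_C = Δ_D` free pro-`Σ` of rank `2`, `2, 3 ∈ Σ` — is abc-iut-L4-t12's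
  `Summit.ABC.IUTFork.not_isMulTorsionFree_of_isFreeProOn` (Summits-side, cited not imported);
* POSITIVE — `inf_geom_torsionFree_of_isFreeProOn`, `mem_semiEllipticDoubleCoverSubgroupsTF_of_isFreeProOn`,
  `mem_semiEllipticDoubleCoverSubgroupsTF_of_geom_isFreeProOn`: at exactly such `J` the PRINT-FAITHFUL
  clause holds (abc-iut-L4's `IsFreeProOn.torsionFree`, [AbsTopI] Lem 4.5 (i)), so `J` lies in the
  successor right-hand side `semiEllipticDoubleCoverSubgroupsTF`.

HONEST FRAMING: classical group theory over the tree's interfaces; refuted-AS-TYPED statements about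
OUR predicates, not about print; nothing here bears on [IUTchIII] Cor 3.12 or asserts that abc is
proved or refuted.  No `def`, no instance; axioms standard.
-/

noncomputable section

namespace Literature.AnabelianGeometry.AbsoluteAnabelian.AbsTopII

open FundamentalExtension

universe u

section Separation

open AbsTopI (ConstructionDataClass)

/-- **The predecessor `Cor_3_3_ii` is FALSE at any model exhibiting ONE genuine double covering
whose `Π_D ∩ Δ_C` lacks unique roots** (e.g. free pro-`Σ` of rank `≥ 2`, `2, 3 ∈ Σ`:
`Summit.ABC.IUTFork.not_isMulTorsionFree_of_isFreeProOn`) — not merely vacuous.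
[cite: MochizukiAbsTopII2013, Cor 3.3 (ii) p.68] -/
theorem cor_3_3_ii_false_of {M : IsogenyModel.{u}} {C : M.Curve} (hC : M.IsSemiElliptic C)
    {J : Subgroup (M.ext C).arith} (hJ : J ∈ M.ellipticDoubleCoverImages C)
    (hnot : ¬ IsMulTorsionFree ↥(J ⊓ (M.ext C).geom)) : ¬ Cor_3_3_ii M := by
  intro h
  have h1 : M.ellipticDoubleCoverImages C = semiEllipticDoubleCoverSubgroups (M.ext C) := h C hC
  rw [h1] at hJ
  exact hnot hJ.2.2

/-- The same for the `(𝒟, M)`-relative predecessor `EllipticModel.Cor_3_3_ii` (F-0290): one member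
of `doubleCovers` whose `Δ`-part lacks unique roots falsifies it.
[cite: MochizukiAbsTopII2013, Cor 3.3 (ii) p.68] -/
theorem EllipticModel.cor_3_3_ii_false_of {𝒟 : ConstructionDataClass.{u}} {M : EllipticModel 𝒟}
    (hfull : 𝒟.IsChainFull) (hrel : 𝒟.RelIsomDGC) {b : 𝒟.Base} {X : (𝒟.datum b).Obj}
    (hX : M.IsCor33Member b X) {J : Subgroup (M.coreExt b X).arith} (hJ : J ∈ M.doubleCovers b X)
    (hnot : ¬ IsMulTorsionFree ↥(J ⊓ (M.coreExt b X).geom)) : ¬ M.Cor_3_3_ii := by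
  intro h
  rw [h hfull hrel b X hX] at hJ
  exact hnot hJ.2.2

/-- The same for abc-iut-L4-t4's datum retype `EllipticDatumModel.Cor_3_3_ii'`: one double cover
COMPUTED FROM THE DATUM whose `Δ`-part lacks unique roots falsifies it.
[cite: MochizukiAbsTopII2013, Cor 3.3 (ii) p.68] -/
theorem EllipticDatumModel.cor_3_3_ii'_false_of {𝒟 : ConstructionDataClass.{u}}
    {M : EllipticDatumModel 𝒟} (hfull : 𝒟.IsChainFull) (hrel : 𝒟.RelIsomDGC)
    {b : 𝒟.Base} {X C : (𝒟.datum b).Obj} (hX : M.IsCor33Member b X)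
    {f : (𝒟.datum b).Hom X C} (hf : M.IsFinEt f) (hcore : M.IsCoreOf b C X)
    {J : Subgroup ((𝒟.datum b).ext C).arith} (hJ : J ∈ M.doubleCoverSubgroups b C)
    (hnot : ¬ IsMulTorsionFree ↥(J ⊓ ((𝒟.datum b).ext C).geom)) :
    ¬ M.Cor_3_3_ii' := by
  intro h
  have heq := h hfull hrel b X hX C f hf hcore
  exact hnot (((M.doubleCoverSubgroups_eq_iff b C).mp heq).1 J hJ)

variable {C : FundamentalExtension.{u}}

/-- For an open `J ⊆ Π`, the subgroup `J ∩ Δ` of the profinite `Π` is closed, hence compact.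
[folklore] -/
private theorem compactSpace_inf_geom' (J : Subgroup C.arith) (hJ : IsOpen (J : Set C.arith)) :
    CompactSpace ↥(J ⊓ C.geom) := by
  have hcl : IsClosed ((J ⊓ C.geom : Subgroup C.arith) : Set C.arith) := by
    rw [Subgroup.coe_inf]
    exact (Subgroup.isClosed_of_isOpen J hJ).inter C.isClosed_geom
  exact isCompact_iff_compactSpace.mp hcl.isCompact

/-- **The print-faithful clause HOLDS where the unique-roots clause fails**: if `J ∩ Δ_C` is free
pro-`Σ` of finite rank ([AbsTopI] Lem 4.5 (i) vocabulary `IsFreeProOn` — e.g. `Π_D ∩ Δ_C = Δ_D`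
for the double covering `D → C` by a once-punctured elliptic curve), then `J ∩ Δ_C` has no
nontrivial element of finite order (`IsFreeProOn.torsionFree`); for rank `≥ 2`, `2, 3 ∈ Σ` the same
`J` is NOT in the landed `semiEllipticDoubleCoverSubgroups`
(`Summit.ABC.IUTFork.not_mem_semiEllipticDoubleCoverSubgroups_of_isFreeProOn`).
[cite: MochizukiAbsTopII2013, Cor 3.3 (ii) p.68] -/
theorem inf_geom_torsionFree_of_isFreeProOn {J : Subgroup C.arith} (hopen : IsOpen (J : Set C.arith))
    {S : Set ℕ} {n : ℕ} {gens : Fin n → ↥(J ⊓ C.geom)} (hfree : IsFreeProOn ↥(J ⊓ C.geom) S gens) :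
    ∀ g : ↥(J ⊓ C.geom), IsOfFinOrder g → g = 1 := by
  haveI := compactSpace_inf_geom' J hopen
  exact hfree.torsionFree

/-- Hence such a `J` (open, index `2`, `J ∩ Δ_C` free pro-`Σ` of finite rank) LIES IN the
print-faithful right-hand side `semiEllipticDoubleCoverSubgroupsTF`.
[cite: MochizukiAbsTopII2013, Cor 3.3 (ii) p.68] -/
theorem mem_semiEllipticDoubleCoverSubgroupsTF_of_isFreeProOn {J : Subgroup C.arith}
    (hopen : IsOpen (J : Set C.arith)) (hindex : J.index = 2)
    {S : Set ℕ} {n : ℕ} {gens : Fin n → ↥(J ⊓ C.geom)} (hfree : IsFreeProOn ↥(J ⊓ C.geom) S gens) :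
    J ∈ semiEllipticDoubleCoverSubgroupsTF C :=
  ⟨hopen, hindex, inf_geom_torsionFree_of_isFreeProOn hopen hfree⟩

/-- And if `Δ_C` itself is free pro-`Σ` of finite rank (e.g. the geometric fundamental group of an
affine hyperbolic CURVE), every open index-`2` subgroup lies in the print-faithful right-hand side.
[cite: MochizukiAbsTopII2013, Cor 3.3 (ii) p.68] -/
theorem mem_semiEllipticDoubleCoverSubgroupsTF_of_geom_isFreeProOn
    {S : Set ℕ} {n : ℕ} {gens : Fin n → ↥C.geom} (hfree : IsFreeProOn ↥C.geom S gens)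
    {J : Subgroup C.arith} (hopen : IsOpen (J : Set C.arith)) (hindex : J.index = 2) :
    J ∈ semiEllipticDoubleCoverSubgroupsTF C := by
  haveI : CompactSpace ↥C.geom := isCompact_iff_compactSpace.mp C.isClosed_geom.isCompact
  exact mem_semiEllipticDoubleCoverSubgroupsTF_of_geom_torsionFree hfree.torsionFree hopen hindex

end Separation

end Literature.AnabelianGeometry.AbsoluteAnabelian.AbsTopII

end
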